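import Literature.Computability.AlgebraicComplexity.WaringRankTrCube
import Literature.Computability.AlgebraicComplexity.SymmetrizedMatMul
import Mathlib.Data.Matrix.Basis
import Mathlib.Tactic.LinearCombination
import Literature.Computability.AlgebraicComplexity.TensorRestrictionRank
import Mathlib.Topology.Algebra.Order.LiminfLimsup
import HarnessLib

/-!
# Discharges of `CHILO2018_rank_le_waringRank`, `CHILO2018_waringRank_le` and
# `CHILO2018_omega_eq_liminf` (Chiantini–Hauenstein–Ikenmeyer–Landsberg–Ottaviani 2018, Thm. 1.1,
# Lemma 1.2, §2 proof of (1.6), p. 4–5)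

Topic `Literature/Computability/AlgebraicComplexity`. This sibling file of `WaringRankTrCube.lean`
PROVES the named facts

* `CHILO2018_rank_le_waringRank_holds : CHILO2018_rank_le_waringRank` —
  `R(⟨n,n,n⟩) ≤ R_S(sM⟨3n⟩)`, i.e. `tensorRank (matMulTensor ℂ n n n) ≤ waringRankTrCube (3 * n)`;
* `CHILO2018_waringRank_le_holds : CHILO2018_waringRank_le` — `R_S(sM⟨n⟩) ≤ 4 R(⟨n,n,n⟩)`
  (Lemma 1.2 for `t = M⟨n⟩`; Part B below);
* `CHILO2018_omega_eq_liminf_holds : CHILO2018_omega_eq_liminf` — Thm. 1.1,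
  `liminf_n log_n R_S(sM⟨n⟩) = ω` (indeed the limit exists, `tendsto_logb_waringRankTrCube`;
  Part C below).

## Part A — `R(⟨n,n,n⟩) ≤ R_S(sM⟨3n⟩)`

The proof is the printed one [CHILO2018, §2, proof of (1.6), p. 5]: "For `n × n` matrices
`A, B, C` consider the `3n × 3n` matrix `X = [[0,0,A],[C,0,0],[0,B,0]]`. Then
`X³ = diag(ABC, CAB, BCA)` and `trace(X³) = 3 trace(ABC)`. This shows that
`R(M⟨n⟩) ≤ R(sM⟨3n⟩)`", combined with `R(P) ≤ R_S(P)` [CHILO2018, (1.5)]. The block matrix and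
`trace(X³) = 3 trace(ABC)` are `chiloBlockMatrixFin` / `trace_chiloBlockMatrixFin_pow_three` of
`SymmetrizedMatMul.lean`; what this file adds is the bookkeeping the paper leaves implicit:

* `waring_polarization` — polarisation of a Waring decomposition `tr(X³) = ∑ᵢ tr(Lᵢ X)³`:
  the inclusion–exclusion combination of the values at `X+Y+Z, X+Y, X+Z, Y+Z, X, Y, Z` equals
  `6 ∑ᵢ tr(Lᵢ X) tr(Lᵢ Y) tr(Lᵢ Z)` [folklore];
* `trace_mul_mul_eq_of_waring` — with `X = X(A,0,0)`, `Y = X(0,B,0)`, `Z = X(0,0,C)` (the block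
  matrix is additive, `chiloBlockMatrixFin_add`) this gives
  `tr(ABC) = 2 ∑ᵢ αᵢ(A) βᵢ(B) γᵢ(C)` with `αᵢ(A) = tr(Lᵢ X(A,0,0))` etc.;
* `matMulTensor_apply_eq_trace_single` — the coordinate tensor `⟨n,n,n⟩` of
  `MatrixMultiplicationExponent.lean` is the trilinear form `(A,B,C) ↦ tr(ABC)` on elementary
  matrices: `⟨n,n,n⟩_{a,b,c} = tr(E_b E_c E_{a.swap})`; hence a length-`r` Waring decomposition of
  `tr(X³)` on `M_{3n}(ℂ)` yields `r` triads summing to `⟨n,n,n⟩`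
  (`matMulTensor_eq_sum_triad_of_waring`, `tensorRank_matMulTensor_le_of_waring`);
* non-emptiness of the set whose infimum is `waringRankTrCube m` (so that the `sInf` is attained,
  `exists_waring_decomposition_waringRankTrCube`): the explicit decomposition
  `tr(A³) = ∑_{i,j,k} A_ij A_jk A_ki` with
  `xyz = (x/24+y+z)³ + (−x/24−y+z)³ + (−x/24+y−z)³ + (x/24−y−z)³`, each linear form being
  `A ↦ tr(L A)` for `L = c₁ E_ji + c₂ E_kj + c₃ E_ik` (`exists_waring_decomposition`), whence
  also the crude bound `waringRankTrCube m ≤ 4 m³` (`waringRankTrCube_le_four_mul_pow`)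
  [folklore; cf. the sharper CHILO2018, §2, p. 5, Proposition "A modest upper bound":
  `R_S(sM⟨n⟩) ≤ 8 C(n,3) + 4 C(n,2) + n`, not vendored].

## Part B — Lemma 1.2 for `t = M⟨n⟩`: `R_S(sM⟨n⟩) ≤ 4 R(⟨n,n,n⟩)`

[CHILO2018, Lemma 1.2]: "For `t ∈ ℂ^N ⊗ ℂ^N ⊗ ℂ^N`, `R_s(𝒮(t)) ≤ 4R(t)` … Proof. If
`t = ∑ᵢ uᵢ ⊗ vᵢ ⊗ wᵢ` then `𝒮(t) = ∑ᵢ (uᵢvᵢwᵢ)`. Since `R_s(xyz) = 4` … this immediately yields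
`R_s(𝒮(t)) ≤ 4R(t)`."  For `t = M⟨n⟩` the cubic `𝒮(M⟨n⟩)(A) = M⟨n⟩(A,A,A)` is `sM⟨n⟩(A) = tr(A³)`
(p. 2), so with the tree's coordinate tensor (`sum_matMulTensor_mul`: the trilinear form of
`⟨n,n,n⟩` is `(x,y,z) ↦ ∑_{κμν} x_{(κ,ν)} y_{(κ,μ)} z_{(μ,ν)}`) a triad decomposition of `⟨n,n,n⟩`
of length `r` writes `tr(A³) = ∑ᵢ tr(WᵢA) tr(UᵢA) tr(VᵢA)` (`trace_pow_three_eq_sum_of_triad`) and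
`mul_mul_eq_sum_four_cubes` turns each product into `4` cubes of linear forms
(`waringRankTrCube_le_four_mul_of_triad`, `waringRankTrCube_le_four_mul_tensorRank`).

## Part C — Thm. 1.1: `liminf_n log_n R_S(sM⟨n⟩) = ω`

[CHILO2018, §2, proof of (1.6), p. 5]: "Lemma 1.2 and (1.5) imply
`4R(M⟨n⟩) ≥ R_s(sM⟨n⟩) ≥ R(sM⟨n⟩)` so that `ω ≥ liminf_n [log_n R_s(sM⟨n⟩)]` … `trace(X³) =
3 trace(ABC)`. This shows that `R(M⟨n⟩) ≤ R(sM⟨3n⟩)` yielding the inequality `ω ≤ liminf_n …`."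
The two uses of Strassen's `ω = lim_n log_n R(M⟨n⟩)` are supplied by the tree's
`rpow_omega_le_tensorRank_matMulTensor` (`n^ω ≤ R(⟨n,n,n⟩)`, Bläser 2013, Thm. 5.9) and
`exists_tensorRank_matMulTensor_le_rpow` (`R(⟨n,n,n⟩) ≤ C_δ n^{ω+δ}`) of
`TensorRestrictionRank.lean`; the passage from `3n` to all `n`, implicit in print, is the
monotonicity `waringRankTrCube_mono` (`m ≤ n → R_S(sM⟨m⟩) ≤ R_S(sM⟨n⟩)`, zero padding
`B ↦ PᵀBP`). Net: for `n ≥ 6`, `(n/4)^ω ≤ R_S(sM⟨n⟩) ≤ 4 C_δ n^{ω+δ}`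
(`rpow_omega_le_waringRankTrCube`), whence `log_n R_S(sM⟨n⟩) → ω`
(`tendsto_logb_waringRankTrCube`) and the `liminf` is `ω` (`CHILO2018_omega_eq_liminf_holds`) — the
printed statement asserts only the `liminf`.

## References

* [CHILO2018] L. Chiantini, J. D. Hauenstein, C. Ikenmeyer, J. M. Landsberg, G. Ottaviani,
  *Polynomials and the exponent of matrix multiplication*, Bull. LMS 50 (2018) 369–389,
  doi:10.1112/blms.12147, arXiv:1706.05074 (held: `arxiv-1706.05074`): Thm. 1.1 (p. 3–4),
  Lemma 1.2 (p. 4), §1 (1.5) `R(P) ≤ R_S(P)` (p. 3), §2 proof of (1.6) (p. 5).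
  Bib key `ChiantiniHauensteinIkenmeyerLandsbergOttaviani2018`.
* [Blaser2013] M. Bläser, *Fast Matrix Multiplication*, Theory of Computing Library, Graduate
  Surveys 5 (2013): §5 (the tensor `⟨k,m,n⟩`), Thm. 5.9 (`ω ≤ log_n R(⟨n,n,n⟩)`).
-/

noncomputable section

open scoped BigOperators
open Matrix

namespace Literature.Computability.AlgebraicComplexity

/-! ## Polarisation of a Waring decomposition of `tr(X³)` -/

section Polarization

variable {N r : ℕ}

/-- **Polarisation** of a Waring decomposition of the cubic `X ↦ tr(X³)`: if
`tr(X³) = ∑ᵢ tr(Lᵢ X)³` identically, then for all `X, Y, Z`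
`p(X+Y+Z) − p(X+Y) − p(X+Z) − p(Y+Z) + p(X) + p(Y) + p(Z) = 6 ∑ᵢ tr(LᵢX) tr(LᵢY) tr(LᵢZ)`
where `p = tr((·)³)` (the symmetric trilinear form of a sum of cubes of linear forms). [folklore] -/
theorem waring_polarization (L : Fin r → Matrix (Fin N) (Fin N) ℂ)
    (hL : ∀ X : Matrix (Fin N) (Fin N) ℂ, (X ^ 3).trace = ∑ i, ((L i * X).trace) ^ 3)
    (X Y Z : Matrix (Fin N) (Fin N) ℂ) :
    ((X + Y + Z) ^ 3).trace - ((X + Y) ^ 3).trace - ((X + Z) ^ 3).trace - ((Y + Z) ^ 3).trace +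
        (X ^ 3).trace + (Y ^ 3).trace + (Z ^ 3).trace =
      6 * ∑ i, (L i * X).trace * (L i * Y).trace * (L i * Z).trace := by
  have key : ∀ i : Fin r,
      ((L i * (X + Y + Z)).trace) ^ 3 - ((L i * (X + Y)).trace) ^ 3 -
          ((L i * (X + Z)).trace) ^ 3 - ((L i * (Y + Z)).trace) ^ 3 + ((L i * X).trace) ^ 3 +
          ((L i * Y).trace) ^ 3 + ((L i * Z).trace) ^ 3 =
        6 * ((L i * X).trace * (L i * Y).trace * (L i * Z).trace) := by
    intro i
    simp only [Matrix.mul_add, trace_add]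
    ring
  simp only [hL]
  rw [Finset.mul_sum, ← Finset.sum_congr rfl fun i _ => key i]
  simp only [Finset.sum_add_distrib, Finset.sum_sub_distrib]

end Polarization

/-! ## The block matrix `X(A, B, C)` is additive -/

section Block

variable {R : Type*} [AddMonoid R] {m : Type*}

/-- `[[0,0,A+A'],[C+C',0,0],[0,B+B',0]] = [[0,0,A],[C,0,0],[0,B,0]] + [[0,0,A'],[C',0,0],[0,B',0]]`
(block pattern level).
[cite: ChiantiniHauensteinIkenmeyerLandsbergOttaviani2018, §2 (proof of (1.6), p. 5)] -/
theorem chiloBlocks_add (A B C A' B' C' : Matrix m m R) :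
    chiloBlocks (A + A') (B + B') (C + C') = chiloBlocks A B C + chiloBlocks A' B' C' := by
  simp only [chiloBlocks, Matrix.of_add_of, Matrix.cons_add_cons, Matrix.empty_add_empty, add_zero]

/-- `X(A + A', B + B', C + C') = X(A, B, C) + X(A', B', C')` (block index `Fin 3 × m`).
[cite: ChiantiniHauensteinIkenmeyerLandsbergOttaviani2018, §2 (proof of (1.6), p. 5)] -/
theorem chiloBlockMatrix_add (A B C A' B' C' : Matrix m m R) :
    chiloBlockMatrix (A + A') (B + B') (C + C') =
      chiloBlockMatrix A B C + chiloBlockMatrix A' B' C' := by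
  ext p q
  rw [Matrix.add_apply, chiloBlockMatrix_apply, chiloBlockMatrix_apply, chiloBlockMatrix_apply,
    chiloBlocks_add, Matrix.add_apply, Matrix.add_apply]

end Block

section BlockFin

variable {R : Type*} [CommSemiring R] {n : ℕ}

/-- `X(A + A', B + B', C + C') = X(A, B, C) + X(A', B', C')` for the `Fin (3n)`-indexed block
matrix. [cite: ChiantiniHauensteinIkenmeyerLandsbergOttaviani2018, §2 (proof of (1.6), p. 5)] -/
theorem chiloBlockMatrixFin_add (A B C A' B' C' : Matrix (Fin n) (Fin n) R) :
    chiloBlockMatrixFin (A + A') (B + B') (C + C') =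
      chiloBlockMatrixFin A B C + chiloBlockMatrixFin A' B' C' := by
  ext p q
  simp only [chiloBlockMatrixFin, chiloBlockMatrix_add, reindex_apply, submatrix_apply,
    Matrix.add_apply]

/-- `X(A, B, C) = X(A, 0, 0) + X(0, B, 0) + X(0, 0, C)`: the block matrix is linear in its three
blocks. [cite: ChiantiniHauensteinIkenmeyerLandsbergOttaviani2018, §2 (proof of (1.6), p. 5)] -/
theorem chiloBlockMatrixFin_eq_add (A B C : Matrix (Fin n) (Fin n) R) :
    chiloBlockMatrixFin A B C =
      chiloBlockMatrixFin A 0 0 + chiloBlockMatrixFin 0 B 0 + chiloBlockMatrixFin 0 0 C := by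
  rw [← chiloBlockMatrixFin_add, ← chiloBlockMatrixFin_add]
  simp only [add_zero, zero_add]

end BlockFin

/-! ## From a Waring decomposition of `tr(X³)` on `M_{3n}` to triads for `⟨n,n,n⟩` -/

section Bridge

variable {n r : ℕ}

/-- **The polarised block-matrix identity**: a Waring decomposition `tr(X³) = ∑ᵢ tr(Lᵢ X)³` on
`M_{3n}(ℂ)` gives, for all `n × n` matrices `A, B, C`,
`tr(ABC) = 2 ∑ᵢ tr(Lᵢ X(A,0,0)) · tr(Lᵢ X(0,B,0)) · tr(Lᵢ X(0,0,C))`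
(polarise `tr(X(A,B,C)³) = 3 tr(ABC)`: the mixed term of the symmetric trilinear form is
`½ tr(ABC)`).
[cite: ChiantiniHauensteinIkenmeyerLandsbergOttaviani2018, §2 (proof of (1.6), p. 5)] -/
theorem trace_mul_mul_eq_of_waring (L : Fin r → Matrix (Fin (3 * n)) (Fin (3 * n)) ℂ)
    (hL : ∀ X : Matrix (Fin (3 * n)) (Fin (3 * n)) ℂ,
      (X ^ 3).trace = ∑ i, ((L i * X).trace) ^ 3)
    (A B C : Matrix (Fin n) (Fin n) ℂ) :
    (A * B * C).trace = 2 * ∑ i, (L i * chiloBlockMatrixFin A 0 0).trace *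
      (L i * chiloBlockMatrixFin 0 B 0).trace * (L i * chiloBlockMatrixFin 0 0 C).trace := by
  have h := waring_polarization L hL (chiloBlockMatrixFin A 0 0) (chiloBlockMatrixFin 0 B 0)
    (chiloBlockMatrixFin 0 0 C)
  simp only [← chiloBlockMatrixFin_add, add_zero, zero_add] at h
  simp only [trace_chiloBlockMatrixFin_pow_three, Matrix.zero_mul, trace_zero, mul_zero, sub_zero,
    add_zero] at h
  linear_combination (1 / 3 : ℂ) * h

/-- The coordinate tensor `⟨n,n,n⟩` is the trilinear form `(A, B, C) ↦ tr(ABC)` evaluated at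
elementary matrices: `⟨n,n,n⟩_{(κ,ν),(κ',μ),(μ',ν')} = tr(E_{κ'μ} E_{μ'ν'} E_{νκ})`
(Bläser 2013, §5: `⟨n,n,n⟩` is the tensor of the bilinear forms `Z_{κν} = ∑_μ X_{κμ} Y_{μν}`;
pairing the output index `(κ,ν)` with the entry `(ν,κ)` of a third matrix gives the trilinear
form `M⟨n⟩(A,B,C) = tr(ABC)` of Chiantini et al. 2018, (1.1)).
[cite: Blaser2013, §5 (the tensor ⟨k,m,n⟩)]
[cite: ChiantiniHauensteinIkenmeyerLandsbergOttaviani2018, §1 (1.1)] -/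
theorem matMulTensor_apply_eq_trace_single {K : Type*} [CommSemiring K]
    (a b c : Fin n × Fin n) :
    matMulTensor K n n n a b c =
      (single b.1 b.2 (1 : K) * single c.1 c.2 1 * single a.2 a.1 1).trace := by
  obtain ⟨a₁, a₂⟩ := a
  obtain ⟨b₁, b₂⟩ := b
  obtain ⟨c₁, c₂⟩ := c
  rw [Matrix.mul_assoc, trace_single_mul, one_smul]
  by_cases h : b₂ = c₁
  · subst h
    rw [single_mul_apply_same, one_mul, single_apply]
    by_cases h₁ : a₁ = b₁ <;> by_cases h₂ : a₂ = c₂ <;> simp [matMulTensor, h₁, h₂]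
  · rw [single_mul_apply_of_ne (h := h)]
    simp [matMulTensor, h]

/-- **Triads from a Waring decomposition**: if `tr(X³) = ∑_{i<r} tr(Lᵢ X)³` on `M_{3n}(ℂ)`, then
`⟨n,n,n⟩ = ∑_{i<r} wᵢ ⊗ uᵢ ⊗ vᵢ` with `wᵢ(κ,ν) = 2 tr(Lᵢ X(0,0,E_{νκ}))`,
`uᵢ(κ,μ) = tr(Lᵢ X(E_{κμ},0,0))`, `vᵢ(μ,ν) = tr(Lᵢ X(0,E_{μν},0))`.
[cite: ChiantiniHauensteinIkenmeyerLandsbergOttaviani2018, §2 (proof of (1.6), p. 5)] -/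
theorem matMulTensor_eq_sum_triad_of_waring (L : Fin r → Matrix (Fin (3 * n)) (Fin (3 * n)) ℂ)
    (hL : ∀ X : Matrix (Fin (3 * n)) (Fin (3 * n)) ℂ,
      (X ^ 3).trace = ∑ i, ((L i * X).trace) ^ 3) :
    matMulTensor ℂ n n n = ∑ i, triad
      (fun a : Fin n × Fin n => 2 * (L i * chiloBlockMatrixFin 0 0 (single a.2 a.1 1)).trace)
      (fun b : Fin n × Fin n => (L i * chiloBlockMatrixFin (single b.1 b.2 1) 0 0).trace)
      (fun c : Fin n × Fin n => (L i * chiloBlockMatrixFin 0 (single c.1 c.2 1) 0).trace) := by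
  funext a b c
  rw [Finset.sum_apply, Finset.sum_apply, Finset.sum_apply]
  simp only [triad_apply]
  rw [matMulTensor_apply_eq_trace_single,
    trace_mul_mul_eq_of_waring L hL (single b.1 b.2 1) (single c.1 c.2 1) (single a.2 a.1 1),
    Finset.mul_sum]
  exact Finset.sum_congr rfl fun i _ => by ring

/-- **`R(⟨n,n,n⟩) ≤ r` from any length-`r` Waring decomposition of `tr(X³)` on `M_{3n}(ℂ)`** —
the polarisation bridge without the minimality of `r`.
[cite: ChiantiniHauensteinIkenmeyerLandsbergOttaviani2018, §2 (proof of (1.6), p. 5)] -/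
theorem tensorRank_matMulTensor_le_of_waring (L : Fin r → Matrix (Fin (3 * n)) (Fin (3 * n)) ℂ)
    (hL : ∀ X : Matrix (Fin (3 * n)) (Fin (3 * n)) ℂ,
      (X ^ 3).trace = ∑ i, ((L i * X).trace) ^ 3) :
    tensorRank (matMulTensor ℂ n n n) ≤ r :=
  tensorRank_le_of_eq_sum _ _ _ (matMulTensor_eq_sum_triad_of_waring L hL)

end Bridge

/-! ## An explicit Waring decomposition of `tr(A³)` (the infimum is attained) -/

section Explicit

variable {m : ℕ}

/-- `trace (A³) = ∑_{i,j,k} A_ij A_jk A_ki`. [folklore] -/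
theorem trace_pow_three_eq_sum {ι : Type*} [Fintype ι] [DecidableEq ι] {R : Type*}
    [CommSemiring R] (A : Matrix ι ι R) :
    (A ^ 3).trace = ∑ i, ∑ j, ∑ k, A i j * A j k * A k i := by
  rw [pow_three', trace]
  refine Finset.sum_congr rfl fun i _ => ?_
  rw [diag_apply, mul_apply, Finset.sum_comm]
  refine Finset.sum_congr rfl fun j _ => ?_
  rw [mul_apply, Finset.sum_mul]

/-- The monomial `xyz` is a sum of four cubes of linear forms:
`xyz = (x/24+y+z)³ + (−x/24−y+z)³ + (−x/24+y−z)³ + (x/24−y−z)³` (so `R_S(xyz) ≤ 4`), written as a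
sum over `s : Fin 4` with coefficient tables. [folklore] -/
theorem mul_mul_eq_sum_four_cubes (x y z : ℂ) :
    x * y * z = ∑ s : Fin 4, ((![1 / 24, -(1 / 24), -(1 / 24), 1 / 24] : Fin 4 → ℂ) s * x +
      (![1, -1, 1, -1] : Fin 4 → ℂ) s * y + (![1, 1, -1, -1] : Fin 4 → ℂ) s * z) ^ 3 := by
  simp only [Fin.sum_univ_four, Matrix.cons_val_zero, Matrix.cons_val_one, Matrix.cons_val_two,
    Matrix.cons_val_three, Matrix.head_cons, Matrix.tail_cons]
  ring

/-- **An explicit Waring decomposition of `tr(A³)` on `M_m(ℂ)`** of length `4 m³`: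
`tr(A³) = ∑_{(i,j,k,s)} tr(L_{(i,j,k,s)} A)³`, where
`L_{(i,j,k,s)} = c₁ₛ E_ji + c₂ₛ E_kj + c₃ₛ E_ik` is the matrix of the linear form
`A ↦ c₁ₛ A_ij + c₂ₛ A_jk + c₃ₛ A_ki` of `mul_mul_eq_sum_four_cubes`. [folklore] -/
theorem exists_waring_decomposition (m : ℕ) :
    ∃ L : Fin m × Fin m × Fin m × Fin 4 → Matrix (Fin m) (Fin m) ℂ,
      ∀ A : Matrix (Fin m) (Fin m) ℂ, (A ^ 3).trace = ∑ p, ((L p * A).trace) ^ 3 := by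
  refine ⟨fun p =>
    single p.2.1 p.1 ((![1 / 24, -(1 / 24), -(1 / 24), 1 / 24] : Fin 4 → ℂ) p.2.2.2) +
      single p.2.2.1 p.2.1 ((![1, -1, 1, -1] : Fin 4 → ℂ) p.2.2.2) +
      single p.1 p.2.2.1 ((![1, 1, -1, -1] : Fin 4 → ℂ) p.2.2.2), fun A => ?_⟩
  rw [trace_pow_three_eq_sum]
  simp only [Fintype.sum_prod_type, Matrix.add_mul, trace_add, trace_single_mul, smul_eq_mul]
  exact Finset.sum_congr rfl fun i _ => Finset.sum_congr rfl fun j _ =>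
    Finset.sum_congr rfl fun k _ => mul_mul_eq_sum_four_cubes _ _ _

/-- A Waring decomposition indexed by a finite type `σ` puts `|σ|` in the set whose infimum is
`waringRankTrCube m`. [folklore] -/
theorem card_mem_waringSet_of_eq_sum {σ : Type*} [Fintype σ] (L : σ → Matrix (Fin m) (Fin m) ℂ)
    (h : ∀ A : Matrix (Fin m) (Fin m) ℂ, (A ^ 3).trace = ∑ s, ((L s * A).trace) ^ 3) :
    Fintype.card σ ∈ {r : ℕ | ∃ (L : Fin r → Matrix (Fin m) (Fin m) ℂ),
      ∀ A : Matrix (Fin m) (Fin m) ℂ, (A ^ 3).trace = ∑ i, ((L i * A).trace) ^ 3} := by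
  set e := Fintype.equivFin σ
  refine ⟨fun i => L (e.symm i), fun A => (h A).trans ?_⟩
  exact Fintype.sum_equiv e _ _ fun s => by simp [e]

/-- The set whose infimum defines `waringRankTrCube m` is non-empty (it contains `4 m³`).
[folklore] -/
theorem waringSet_nonempty (m : ℕ) :
    {r : ℕ | ∃ (L : Fin r → Matrix (Fin m) (Fin m) ℂ),
      ∀ A : Matrix (Fin m) (Fin m) ℂ, (A ^ 3).trace = ∑ i, ((L i * A).trace) ^ 3}.Nonempty := by
  obtain ⟨L, hL⟩ := exists_waring_decomposition m
  exact ⟨_, card_mem_waringSet_of_eq_sum L hL⟩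

/-- **The Waring rank of `tr(A³)` is attained**: there is a Waring decomposition of `tr(A³)` on
`M_m(ℂ)` of length exactly `waringRankTrCube m`. [folklore] -/
theorem exists_waring_decomposition_waringRankTrCube (m : ℕ) :
    ∃ L : Fin (waringRankTrCube m) → Matrix (Fin m) (Fin m) ℂ,
      ∀ A : Matrix (Fin m) (Fin m) ℂ, (A ^ 3).trace = ∑ i, ((L i * A).trace) ^ 3 :=
  Nat.sInf_mem (waringSet_nonempty m)

/-- The crude bound `R_S(tr(A³) on M_m) ≤ 4 m³` (each of the `m³` monomials `A_ij A_jk A_ki` is a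
sum of `4` cubes). [folklore] -/
theorem waringRankTrCube_le_four_mul_pow (m : ℕ) : waringRankTrCube m ≤ 4 * m ^ 3 := by
  obtain ⟨L, hL⟩ := exists_waring_decomposition m
  have h := Nat.sInf_le (card_mem_waringSet_of_eq_sum L hL)
  have hc : Fintype.card (Fin m × Fin m × Fin m × Fin 4) = 4 * m ^ 3 := by
    simp only [Fintype.card_prod, Fintype.card_fin]
    ring
  rw [hc] at h
  exact h

end Explicit

/-! ## The named fact -/

/-- **DISCHARGE of `CHILO2018_rank_le_waringRank`**: `R(⟨n,n,n⟩) ≤ R_S(sM⟨3n⟩)` for all `n`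
(Chiantini et al. 2018, §2, proof of (1.6), p. 5: via `X(A,B,C)` with `tr(X³) = 3 tr(ABC)`,
`R(M⟨n⟩) ≤ R(sM⟨3n⟩) ≤ R_S(sM⟨3n⟩)`). A minimal Waring decomposition exists
(`exists_waring_decomposition_waringRankTrCube`) and polarises to `waringRankTrCube (3n)` triads
summing to `⟨n,n,n⟩` (`tensorRank_matMulTensor_le_of_waring`).
[cite: ChiantiniHauensteinIkenmeyerLandsbergOttaviani2018, §2 (proof of (1.6), p. 5)] -/
theorem CHILO2018_rank_le_waringRank_holds : CHILO2018_rank_le_waringRank := fun n => by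
  obtain ⟨L, hL⟩ := exists_waring_decomposition_waringRankTrCube (3 * n)
  exact tensorRank_matMulTensor_le_of_waring L hL

/-! ## Part B — Lemma 1.2 for `t = M⟨n⟩`: `R_S(sM⟨n⟩) ≤ 4 R(M⟨n⟩)` -/

section LemmaOneTwo

/-- Expanding a product of three finite sums. [folklore] -/
theorem sum_mul_sum_mul_sum_expand {α β γ R : Type*} [Fintype α] [Fintype β] [Fintype γ]
    [CommSemiring R] (f : α → R) (g : β → R) (h : γ → R) :
    (∑ a, f a) * (∑ b, g b) * (∑ c, h c) = ∑ a, ∑ b, ∑ c, f a * g b * h c := by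
  rw [Finset.sum_mul_sum, Finset.sum_mul]
  refine Finset.sum_congr rfl fun a _ => ?_
  rw [Finset.sum_mul]
  refine Finset.sum_congr rfl fun b _ => ?_
  rw [Finset.mul_sum]

/-- Moving the outermost of four finite sums innermost. [folklore] -/
theorem sum_rotate₄ {α β γ δ M : Type*} [Fintype α] [Fintype β] [Fintype γ] [Fintype δ]
    [AddCommMonoid M] (f : α → β → γ → δ → M) :
    ∑ i, ∑ a, ∑ b, ∑ c, f i a b c = ∑ a, ∑ b, ∑ c, ∑ i, f i a b c := by
  calc ∑ i, ∑ a, ∑ b, ∑ c, f i a b c = ∑ a, ∑ i, ∑ b, ∑ c, f i a b c := Finset.sum_comm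
    _ = ∑ a, ∑ b, ∑ i, ∑ c, f i a b c := Finset.sum_congr rfl fun a _ => Finset.sum_comm
    _ = ∑ a, ∑ b, ∑ c, ∑ i, f i a b c :=
        Finset.sum_congr rfl fun a _ => Finset.sum_congr rfl fun b _ => Finset.sum_comm

/-- The trilinear form of the coordinate tensor `⟨k,m,n⟩`:
`∑_{a,b,c} ⟨k,m,n⟩_{abc} x_a y_b z_c = ∑_{κ,μ,ν} x_{(κ,ν)} y_{(κ,μ)} z_{(μ,ν)}` (Bläser 2013, §5:
`⟨k,m,n⟩` is the tensor of the bilinear forms `Z_{κν} = ∑_μ X_{κμ} Y_{μν}`).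
[cite: Blaser2013, §5 (the tensor ⟨k,m,n⟩)] -/
theorem sum_matMulTensor_mul {K : Type*} [CommSemiring K] {k m n : ℕ} (x : Fin k × Fin n → K)
    (y : Fin k × Fin m → K) (z : Fin m × Fin n → K) :
    ∑ a, ∑ b, ∑ c, matMulTensor K k m n a b c * (x a * y b * z c) =
      ∑ κ, ∑ μ, ∑ ν, x (κ, ν) * y (κ, μ) * z (μ, ν) := by
  have hc : ∀ (a : Fin k × Fin n) (b : Fin k × Fin m),
      ∑ c, matMulTensor K k m n a b c * (x a * y b * z c) =
        if a.1 = b.1 then x a * y b * z (b.2, a.2) else 0 := by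
    intro a b
    rw [Finset.sum_eq_single (b.2, a.2)]
    · by_cases h : a.1 = b.1 <;> simp [matMulTensor, h]
    · rintro ⟨c₁, c₂⟩ - hne
      have h' : ¬(a.1 = b.1 ∧ b.2 = c₁ ∧ a.2 = c₂) := by
        rintro ⟨-, rfl, rfl⟩
        exact hne rfl
      simp [matMulTensor, h']
    · intro h
      exact absurd (Finset.mem_univ _) h
  have hb : ∀ a : Fin k × Fin n,
      ∑ b, ∑ c, matMulTensor K k m n a b c * (x a * y b * z c) =
        ∑ μ, x a * y (a.1, μ) * z (μ, a.2) := by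
    intro a
    simp_rw [hc]
    rw [Fintype.sum_prod_type, Finset.sum_comm]
    simp only [Finset.sum_ite_eq, Finset.mem_univ, if_true]
  simp_rw [hb]
  rw [Fintype.sum_prod_type]
  exact Finset.sum_congr rfl fun κ _ => Finset.sum_comm

variable {n : ℕ}

/-- **`tr(A³)` from a triad decomposition of `⟨n,n,n⟩`**: if `⟨n,n,n⟩ = ∑ᵢ wᵢ ⊗ uᵢ ⊗ vᵢ` then
`tr(A³) = ∑ᵢ tr(Wᵢ A) · tr(Uᵢ A) · tr(Vᵢ A)` with `(Wᵢ)_{kl} = wᵢ(k,l)`, `(Uᵢ)_{kl} = uᵢ(l,k)`,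
`(Vᵢ)_{kl} = vᵢ(l,k)` — the cubic `A ↦ M⟨n⟩(A,A,A) = 𝒮(M⟨n⟩)(A) = tr(A³)` written through the
rank decomposition (Chiantini et al. 2018, proof of Lemma 1.2: "if `t = ∑ uᵢ ⊗ vᵢ ⊗ wᵢ` then
`𝒮(t) = ∑ (uᵢ vᵢ wᵢ)`"; `sM⟨n⟩(A) = trace(A³)`, p. 2).
[cite: ChiantiniHauensteinIkenmeyerLandsbergOttaviani2018, Lemma 1.2 (proof)] -/
theorem trace_pow_three_eq_sum_of_triad {r : ℕ} (w u v : Fin r → Fin n × Fin n → ℂ)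
    (e : matMulTensor ℂ n n n = ∑ i, triad (w i) (u i) (v i)) (A : Matrix (Fin n) (Fin n) ℂ) :
    (A ^ 3).trace = ∑ i, (Matrix.of (fun k l => w i (k, l)) * A).trace *
      (Matrix.of (fun k l => u i (l, k)) * A).trace *
        (Matrix.of (fun k l => v i (l, k)) * A).trace := by
  -- the three linear forms as coordinate sums
  have hW : ∀ i, (Matrix.of (fun k l => w i (k, l)) * A).trace =
      ∑ a : Fin n × Fin n, w i a * A a.2 a.1 := by
    intro i
    rw [trace, Fintype.sum_prod_type]
    refine Finset.sum_congr rfl fun k _ => ?_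
    rw [diag_apply, mul_apply]
    rfl
  have hU : ∀ i, (Matrix.of (fun k l => u i (l, k)) * A).trace =
      ∑ b : Fin n × Fin n, u i b * A b.1 b.2 := by
    intro i
    rw [trace, Fintype.sum_prod_type, Finset.sum_comm]
    refine Finset.sum_congr rfl fun k _ => ?_
    rw [diag_apply, mul_apply]
    rfl
  have hV : ∀ i, (Matrix.of (fun k l => v i (l, k)) * A).trace =
      ∑ c : Fin n × Fin n, v i c * A c.1 c.2 := by
    intro i
    rw [trace, Fintype.sum_prod_type, Finset.sum_comm]
    refine Finset.sum_congr rfl fun k _ => ?_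
    rw [diag_apply, mul_apply]
    rfl
  have hM : ∀ a b c : Fin n × Fin n,
      ∑ i, w i a * A a.2 a.1 * (u i b * A b.1 b.2) * (v i c * A c.1 c.2) =
        matMulTensor ℂ n n n a b c * (A a.2 a.1 * A b.1 b.2 * A c.1 c.2) := by
    intro a b c
    rw [e, sum_triad_apply, Finset.sum_mul]
    exact Finset.sum_congr rfl fun i _ => by ring
  simp_rw [hW, hU, hV, sum_mul_sum_mul_sum_expand]
  rw [sum_rotate₄, trace_pow_three_eq_sum]
  simp_rw [hM]
  rw [sum_matMulTensor_mul]
  exact Finset.sum_congr rfl fun κ _ => Finset.sum_congr rfl fun μ _ =>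
    Finset.sum_congr rfl fun ν _ => by ring

/-- **Lemma 1.2 of Chiantini et al. 2018 for `t = M⟨n⟩`, decomposition form**: a triad
decomposition `⟨n,n,n⟩ = ∑_{i<r} wᵢ ⊗ uᵢ ⊗ vᵢ` gives `R_S(sM⟨n⟩) ≤ 4r` —
`tr(A³) = ∑ᵢ tr(WᵢA) tr(UᵢA) tr(VᵢA)` and each product of three linear forms is a sum of `4`
cubes of linear forms (`R_S(xyz) = 4`, `mul_mul_eq_sum_four_cubes`), the linear forms being
`A ↦ tr((c₁Wᵢ + c₂Uᵢ + c₃Vᵢ) A)`.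
[cite: ChiantiniHauensteinIkenmeyerLandsbergOttaviani2018, Lemma 1.2] -/
theorem waringRankTrCube_le_four_mul_of_triad {r : ℕ} (w u v : Fin r → Fin n × Fin n → ℂ)
    (e : matMulTensor ℂ n n n = ∑ i, triad (w i) (u i) (v i)) :
    waringRankTrCube n ≤ 4 * r := by
  have hdec : ∀ A : Matrix (Fin n) (Fin n) ℂ, (A ^ 3).trace = ∑ p : Fin r × Fin 4,
      ((((![1 / 24, -(1 / 24), -(1 / 24), 1 / 24] : Fin 4 → ℂ) p.2 •
          Matrix.of (fun k l => w p.1 (k, l)) +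
        (![1, -1, 1, -1] : Fin 4 → ℂ) p.2 • Matrix.of (fun k l => u p.1 (l, k)) +
        (![1, 1, -1, -1] : Fin 4 → ℂ) p.2 •
          Matrix.of (fun k l => v p.1 (l, k))) * A).trace) ^ 3 := by
    intro A
    rw [trace_pow_three_eq_sum_of_triad w u v e A, Fintype.sum_prod_type]
    refine Finset.sum_congr rfl fun i _ => ?_
    rw [mul_mul_eq_sum_four_cubes]
    refine Finset.sum_congr rfl fun s _ => ?_
    simp only [Matrix.add_mul, Matrix.smul_mul, trace_add, trace_smul, smul_eq_mul]
  have h := Nat.sInf_le (card_mem_waringSet_of_eq_sum _ hdec)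
  have hc : Fintype.card (Fin r × Fin 4) = 4 * r := by
    simp only [Fintype.card_prod, Fintype.card_fin]
    ring
  rw [hc] at h
  exact h

/-- **Lemma 1.2 of Chiantini et al. 2018 for `t = M⟨n⟩`**: `R_S(sM⟨n⟩) ≤ 4 · R(M⟨n⟩)`
("`R_s(𝒮(t)) ≤ 4R(t)`" with `𝒮(M⟨n⟩)(A) = sM⟨n⟩(A) = tr(A³)`; used as "`4R(M⟨n⟩) ≥ R_s(sM⟨n⟩)`"
in the proof of (1.6), p. 5). A minimal rank decomposition exists
(`exists_triad_decomposition_tensorRank`).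
[cite: ChiantiniHauensteinIkenmeyerLandsbergOttaviani2018, Lemma 1.2] -/
theorem waringRankTrCube_le_four_mul_tensorRank (n : ℕ) :
    waringRankTrCube n ≤ 4 * tensorRank (matMulTensor ℂ n n n) := by
  obtain ⟨w, u, v, e⟩ := exists_triad_decomposition_tensorRank (matMulTensor ℂ n n n)
  exact waringRankTrCube_le_four_mul_of_triad w u v e

/-- **DISCHARGE of `CHILO2018_waringRank_le`**: `R_S(sM⟨n⟩) ≤ 4 · R(M⟨n⟩)` for all `n`
(Chiantini et al. 2018, Lemma 1.2 with `𝒮(M⟨n⟩)(A) = tr(A³)`, as used in the proof of (1.6)).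
[cite: ChiantiniHauensteinIkenmeyerLandsbergOttaviani2018, Lemma 1.2] -/
theorem CHILO2018_waringRank_le_holds : CHILO2018_waringRank_le :=
  waringRankTrCube_le_four_mul_tensorRank

end LemmaOneTwo

/-! ## Part C — monotonicity of `R_S(sM⟨n⟩)` in `n` (zero padding) -/

section Mono

variable {m n : ℕ}

/-- **Monotonicity of the Waring rank of `tr(A³)` in the matrix size**: for `m ≤ n`,
`R_S(sM⟨m⟩) ≤ R_S(sM⟨n⟩)` — restrict a Waring decomposition on `M_n(ℂ)` to the zero-padded
matrices `Pᵀ B P` (`B ∈ M_m(ℂ)`, `P ∈ ℂ^{m×n}` the coordinate embedding, `P Pᵀ = 1`):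
`tr((PᵀBP)³) = tr(B³)` and `tr(L PᵀBP) = tr((P L Pᵀ) B)` (the passage from `3n` to all `n` left
implicit in Chiantini et al. 2018, proof of (1.6), p. 5). [folklore] -/
theorem waringRankTrCube_mono (h : m ≤ n) : waringRankTrCube m ≤ waringRankTrCube n := by
  obtain ⟨L, hL⟩ := exists_waring_decomposition_waringRankTrCube n
  -- the coordinate embedding `P_{ik} = [castLE i = k]`
  set P : Matrix (Fin m) (Fin n) ℂ := Matrix.of fun i k => if Fin.castLE h i = k then 1 else 0
    with hP
  have hPP : P * Pᵀ = 1 := by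
    ext i j
    rw [mul_apply, one_apply]
    simp only [hP, transpose_apply, of_apply, ite_mul, one_mul, zero_mul, Finset.sum_ite_eq,
      Finset.mem_univ, if_true]
    by_cases hij : i = j
    · subst hij
      simp
    · have hne : Fin.castLE h j ≠ Fin.castLE h i :=
        fun h' => hij ((Fin.castLE_injective h) h').symm
      simp [hij, hne]
  refine waringRankTrCube_le (fun i => P * L i * Pᵀ) fun B => ?_
  have key := hL (Pᵀ * B * P)
  have hcube : (Pᵀ * B * P) ^ 3 = Pᵀ * B ^ 3 * P := by
    rw [pow_three, pow_three]
    calc Pᵀ * B * P * (Pᵀ * B * P * (Pᵀ * B * P))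
        = Pᵀ * B * (P * Pᵀ) * B * (P * Pᵀ) * B * P := by
          simp only [Matrix.mul_assoc]
      _ = Pᵀ * (B * (B * B)) * P := by
          rw [hPP, Matrix.mul_one, Matrix.mul_one]
          simp only [Matrix.mul_assoc]
  rw [hcube, trace_mul_cycle, hPP, Matrix.one_mul] at key
  rw [key]
  refine Finset.sum_congr rfl fun i _ => ?_
  congr 1
  calc (L i * (Pᵀ * B * P)).trace = (L i * Pᵀ * B * P).trace := by simp only [Matrix.mul_assoc]
    _ = (P * (L i * Pᵀ * B)).trace := trace_mul_comm _ _
    _ = (P * L i * Pᵀ * B).trace := by simp only [Matrix.mul_assoc]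

end Mono

/-! ## Part C — `log_n R_S(sM⟨n⟩) → ω` and Thm. 1.1 -/

section Omega

open Filter
open scoped Topology

/-- **Lower bound**: for `n ≥ 6`, `(n/4)^ω ≤ R_S(sM⟨n⟩)` — with `m = ⌊n/3⌋ ≥ n/4`,
`m^ω ≤ R(M⟨m⟩) ≤ R_S(sM⟨3m⟩) ≤ R_S(sM⟨n⟩)` (Bläser 2013, Thm. 5.9: `ω ≤ log_m R(M⟨m⟩)`,
`rpow_omega_le_tensorRank_matMulTensor`; Chiantini et al. 2018, proof of (1.6):
`R(M⟨m⟩) ≤ R_S(sM⟨3m⟩)`, `CHILO2018_rank_le_waringRank_holds`; monotonicity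
`waringRankTrCube_mono`).
[cite: ChiantiniHauensteinIkenmeyerLandsbergOttaviani2018, §2 (proof of (1.6), p. 5)] -/
theorem rpow_omega_le_waringRankTrCube {n : ℕ} (hn : 6 ≤ n) :
    ((n : ℝ) / 4) ^ omega ℂ ≤ (waringRankTrCube n : ℝ) := by
  have hm2 : 2 ≤ n / 3 := by omega
  have h3m : 3 * (n / 3) ≤ n := by omega
  have h4m : n ≤ (n / 3) * 4 := by omega
  have hω0 : 0 ≤ omega ℂ := zero_le_two.trans (omega_two_le ℂ)
  have hnat : tensorRank (matMulTensor ℂ (n / 3) (n / 3) (n / 3)) ≤ waringRankTrCube n :=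
    (CHILO2018_rank_le_waringRank_holds (n / 3)).trans (waringRankTrCube_mono h3m)
  calc ((n : ℝ) / 4) ^ omega ℂ ≤ ((n / 3 : ℕ) : ℝ) ^ omega ℂ := by
        refine Real.rpow_le_rpow (by positivity) ?_ hω0
        rw [div_le_iff₀ (by norm_num : (0 : ℝ) < 4)]
        exact_mod_cast h4m
    _ ≤ tensorRank (matMulTensor ℂ (n / 3) (n / 3) (n / 3)) :=
        rpow_omega_le_tensorRank_matMulTensor ℂ hm2
    _ ≤ waringRankTrCube n := by exact_mod_cast hnat

/-- Positivity: `R_S(sM⟨n⟩) > 0` for `n ≥ 6` (indeed `≥ (n/4)^ω`). [folklore] -/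
theorem waringRankTrCube_cast_pos {n : ℕ} (hn : 6 ≤ n) : (0 : ℝ) < waringRankTrCube n := by
  refine lt_of_lt_of_le ?_ (rpow_omega_le_waringRankTrCube hn)
  have h6 : (6 : ℝ) ≤ n := by exact_mod_cast hn
  exact Real.rpow_pos_of_pos (by linarith) _

/-- **Strassen–CHILO limit**: `log_n R_S(sM⟨n⟩) → ω` as `n → ∞` (the limit exists; Chiantini et
al. 2018, Thm. 1.1 states `ω = liminf_n log_n R_S(sM⟨n⟩)`; proof of (1.6), p. 5:
`4R(M⟨n⟩) ≥ R_S(sM⟨n⟩)` and `R(M⟨n⟩) ≤ R_S(sM⟨3n⟩)`, combined with Strassen's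
`ω = lim_n log_n R(M⟨n⟩)`, here in the form `n^ω ≤ R(M⟨n⟩) ≤ C_δ n^{ω+δ}` of
`TensorRestrictionRank.lean`): for `n ≥ 6`,
`ω − ω log 4 / log n ≤ log_n R_S(sM⟨n⟩) ≤ ω + δ + log(4C_δ) / log n`.
[cite: ChiantiniHauensteinIkenmeyerLandsbergOttaviani2018, Thm. 1.1 (proof of (1.6), §2)] -/
theorem tendsto_logb_waringRankTrCube :
    Tendsto (fun n : ℕ => Real.logb n (waringRankTrCube n : ℝ)) atTop (𝓝 (omega ℂ)) := by
  have hlog : Tendsto (fun n : ℕ => Real.log (n : ℝ)) atTop atTop :=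
    Real.tendsto_log_atTop.comp tendsto_natCast_atTop_atTop
  rw [tendsto_order]
  constructor
  · -- lower bound: `a < ω` ⟹ eventually `a < log_n R_S(sM⟨n⟩)`
    intro a ha
    have h0 : Tendsto (fun n : ℕ => omega ℂ * Real.log 4 / Real.log (n : ℝ)) atTop (𝓝 0) :=
      tendsto_const_nhds.div_atTop hlog
    filter_upwards [eventually_ge_atTop 6, h0.eventually (gt_mem_nhds (sub_pos.2 ha))]
      with n hn hn'
    have hn1 : (1 : ℝ) < n := by exact_mod_cast (show 1 < n by omega)
    have hlogn : 0 < Real.log (n : ℝ) := Real.log_pos hn1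
    have hn0 : (0 : ℝ) < n := by linarith
    have hW := waringRankTrCube_cast_pos hn
    have hlow := rpow_omega_le_waringRankTrCube hn
    -- `log ((n/4)^ω) = ω (log n - log 4) ≤ log R_S`
    have h1 : omega ℂ * (Real.log n - Real.log 4) ≤ Real.log (waringRankTrCube n : ℝ) := by
      have := Real.log_le_log (Real.rpow_pos_of_pos (by positivity) _) hlow
      rwa [Real.log_rpow (by positivity), Real.log_div hn0.ne' (by norm_num)] at this
    rw [Real.logb, lt_div_iff₀ hlogn]
    rw [div_lt_iff₀ hlogn] at hn'
    have h2 : a * Real.log n < omega ℂ * (Real.log n - Real.log 4) := by linarith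
    exact h2.trans_le h1
  · -- upper bound: `ω < b` ⟹ eventually `log_n R_S(sM⟨n⟩) < b`
    intro b hb
    have hδ0 : 0 < (b - omega ℂ) / 2 := half_pos (sub_pos.2 hb)
    obtain ⟨C, hC, hCb⟩ := exists_tensorRank_matMulTensor_le_rpow ℂ hδ0
    have h0 : Tendsto (fun n : ℕ => Real.log (4 * C) / Real.log (n : ℝ)) atTop (𝓝 0) :=
      tendsto_const_nhds.div_atTop hlog
    filter_upwards [eventually_ge_atTop 6, h0.eventually (gt_mem_nhds hδ0)] with n hn hn'
    have hn1 : (1 : ℝ) < n := by exact_mod_cast (show 1 < n by omega)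
    have hlogn : 0 < Real.log (n : ℝ) := Real.log_pos hn1
    have hn0 : (0 : ℝ) < n := by linarith
    have hW := waringRankTrCube_cast_pos hn
    -- `R_S ≤ 4 R(M⟨n⟩) ≤ 4 C n^{ω+δ}`
    have hup : (waringRankTrCube n : ℝ) ≤ 4 * C * (n : ℝ) ^ (omega ℂ + (b - omega ℂ) / 2) := by
      have h1 : (waringRankTrCube n : ℝ) ≤ 4 * tensorRank (matMulTensor ℂ n n n) := by
        exact_mod_cast waringRankTrCube_le_four_mul_tensorRank n
      have h2 := hCb n (by omega)
      calc (waringRankTrCube n : ℝ) ≤ 4 * tensorRank (matMulTensor ℂ n n n) := h1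
        _ ≤ 4 * (C * (n : ℝ) ^ (omega ℂ + (b - omega ℂ) / 2)) := by linarith
        _ = 4 * C * (n : ℝ) ^ (omega ℂ + (b - omega ℂ) / 2) := by ring
    have h3 : Real.log (waringRankTrCube n : ℝ) ≤
        Real.log (4 * C) + (omega ℂ + (b - omega ℂ) / 2) * Real.log n := by
      have := Real.log_le_log hW hup
      rwa [Real.log_mul (by positivity) (Real.rpow_pos_of_pos hn0 _).ne', Real.log_rpow hn0]
        at this
    rw [Real.logb, div_lt_iff₀ hlogn]
    rw [div_lt_iff₀ hlogn] at hn'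
    have h4 : Real.log (4 * C) + (omega ℂ + (b - omega ℂ) / 2) * Real.log n < b * Real.log n := by
      have hb' : b * Real.log n =
          (omega ℂ + (b - omega ℂ) / 2) * Real.log n + (b - omega ℂ) / 2 * Real.log n := by ring
      rw [hb']
      linarith
    exact h3.trans_lt h4

/-- **DISCHARGE of `CHILO2018_omega_eq_liminf`** (Chiantini–Hauenstein–Ikenmeyer–Landsberg–
Ottaviani 2018, Thm. 1.1, the equality `ω = liminf_n [log_n R_s(sM⟨n⟩)]`): the sequence
`log_n R_S(sM⟨n⟩)` even converges to `ω` (`tendsto_logb_waringRankTrCube`), so its `liminf` is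
`ω`. [cite: ChiantiniHauensteinIkenmeyerLandsbergOttaviani2018, Thm. 1.1] -/
theorem CHILO2018_omega_eq_liminf_holds : CHILO2018_omega_eq_liminf :=
  tendsto_logb_waringRankTrCube.liminf_eq

end Omega

end Literature.Computability.AlgebraicComplexity

end
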